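import Mathlib

/-!
# HeegnerRankOne — the Weil representation of the T₈-face discriminant form (solo-blind s47)

The T₈ face of the K3 period space has rational transcendental lattice `T_ℚ ≅ ⟨1,1,−1⁶⟩`; an
integral model is `L = U² ⊕ D₄(−1)` with discriminant form `A_L = 𝔽₂²`, `q ≡ 1/2` on the three
non-zero classes (anisotropic, level 2, signature `2 − 6 ≡ 4 mod 8`).  Borcherds' obstruction
theory says that the classes of the Heegner (Noether–Lefschetz) divisors of the face span a
subspace of `Pic ⊗ ℚ` of dimension `1 + dim S_{4,L}`, where `S_{4,L}` is the space of cusp forms of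
weight `4 = 1 + 6/2` for the Weil representation `ρ_L` of `SL₂(ℤ)` on `ℂ[A_L]`.

This file certifies the finite part of the computation `dim M_{4,L} = 1`, `S_{4,L} = 0`
(HOME `work/s47/nl-face.md` §1, claim SB-C375), namely that the explicit matrices
`ρ(T) = diag(e(q(γ))) = diag(1,−1,−1,−1)` and `ρ(S) = (√i)^{6−2}/√|A_L| · (e(−(γ,δ)))_{γ,δ} = −M/2`
satisfy the relations of `SL₂(ℤ/2ℤ) ≅ S₃` (`S² = T² = (ST)³ = 1`), so that `ρ_L` factors through
`S₃`, and that its character `(4, −2, 1)` on (identity, involutions, 3-cycles) has multiplicity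
exactly one against the permutation character `(3, 1, 0)` of `S₃` on the three cusps of `Γ(2)`
(and decomposes as `sgn ⊕ sgn ⊕ std`).  To stay inside integer arithmetic we work with
`M = −2ρ(S)` and `Tm = ρ(T)`: the relations become `M² = 4·1`, `Tm² = 1`, `(M·Tm)³ = −8·1`, the
traces `tr M = 4` (`tr ρ(S) = −2`), `tr (M·Tm) = −2` (`tr ρ(ST) = 1`), `tr Tm = −2`.
We also certify that the finite quadratic form is a genuine quadratic refinement of the
bilinear form read off from `M` (group law = xor on `𝔽₂²`) and is anisotropic (only `γ = 0` is
isotropic, so the Eisenstein space is spanned by the single series `E₀`).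

What stays on paper: `M₄(Γ(2)) = Eis₄(Γ(2))` is the permutation module on the cusps and
`S₄(Γ(2)) = 0` (genus 0, three cusps), and Borcherds' theorems themselves.  All proofs are
closed computations by `decide`; no `native_decide`, no extra axioms.
-/

namespace Summit.HodgeConjecture.HodgeConjecture.Theorems.HeegnerRankOne

/-- A 4×4 integer matrix as a list of rows (indices = the four classes of `𝔽₂²`,
ordered `0=(0,0), 1=(1,0), 2=(0,1), 3=(1,1)`). -/
abbrev M4 := List (List ℤ)

/-- Entry accessor (out-of-range entries read as 0). -/
def ent (A : M4) (i j : ℕ) : ℤ := (A.getD i []).getD j 0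

/-- Matrix product of 4×4 list matrices. -/
def mul (A B : M4) : M4 :=
  (List.range 4).map fun i => (List.range 4).map fun j =>
    ((List.range 4).map fun k => ent A i k * ent B k j).sum

/-- Scalar matrix `c·1`. -/
def scalar (c : ℤ) : M4 :=
  (List.range 4).map fun i => (List.range 4).map fun j => if i = j then c else 0

/-- Trace. -/
def tr (A : M4) : ℤ := ((List.range 4).map fun i => ent A i i).sum

/-- The finite quadratic form in half-units: `q(γ) = qHalf γ / 2 mod 1`. -/
def qHalf (γ : ℕ) : ℤ := if γ = 0 then 0 else 1

/-- Group law of `𝔽₂²` on the labels `0..3`. -/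
def add (γ δ : ℕ) : ℕ := γ ^^^ δ

/-- The bilinear form in half-units: `(γ,δ) = bHalf γ δ / 2 mod 1`, defined as the polarisation of `q`. -/
def bHalf (γ δ : ℕ) : ℤ := (qHalf (add γ δ) - qHalf γ - qHalf δ) % 2

/-- `M_{γδ} = e(−(γ,δ)) ∈ {±1}`; `ρ(S) = −M/2`. -/
def M : M4 := (List.range 4).map fun γ => (List.range 4).map fun δ => if bHalf γ δ = 0 then 1 else -1

/-- `ρ(T) = diag(e(q(γ)))`. -/
def Tm : M4 := (List.range 4).map fun γ => (List.range 4).map fun δ =>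
  if γ = δ then (if qHalf γ = 0 then 1 else -1) else 0

/-! ## The certificates -/

/-- `M` is the explicit sign matrix. -/
theorem M_eq : M = [[1, 1, 1, 1], [1, 1, -1, -1], [1, -1, 1, -1], [1, -1, -1, 1]] := by decide

/-- `ρ(S)² = 1`, i.e. `M² = 4·1`. -/
theorem S_sq : mul M M = scalar 4 := by decide

/-- `ρ(T)² = 1`. -/
theorem T_sq : mul Tm Tm = scalar 1 := by decide

/-- `(ρ(S)ρ(T))³ = 1`, i.e. `(M·Tm)³ = −8·1` (since `ρ(S)ρ(T) = −M·Tm/2`). -/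
theorem ST_cubed : mul (mul (mul M Tm) (mul M Tm)) (mul M Tm) = scalar (-8) := by decide

/-- Traces: `tr M = 4` (`tr ρ(S) = −2`), `tr (M·Tm) = −2` (`tr ρ(ST) = 1`), `tr ρ(T) = −2`;
so the character of `ρ_L` on (1, involution, 3-cycle) of `S₃` is `(4, −2, 1)`. -/
theorem traces : (tr (scalar 1), tr M, tr (mul M Tm), tr Tm) = (4, 4, -2, -2) := by decide

/-- The quadratic form is anisotropic: only the zero class is isotropic. -/
theorem anisotropic : ((List.range 4).filter fun γ => qHalf γ = 0) = [0] := by decide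

/-- `q` takes the value `1/2` on every non-zero class and the bilinear form is `1/2` exactly on
pairs of distinct non-zero classes (the discriminant form of `D₄`). -/
theorem form_table :
    ((List.range 4).map qHalf, (List.range 4).map fun γ => (List.range 4).map fun δ => bHalf γ δ)
      = ([0, 1, 1, 1], [[0, 0, 0, 0], [0, 0, 1, 1], [0, 1, 0, 1], [0, 1, 1, 0]]) := by decide

/-- Character arithmetic in `S₃` (class sizes 1, 3, 2): with `χ_ρ = (4,−2,1)`,
`χ_perm = (3,1,0)` (cusps of `Γ(2)`), `χ_triv = (1,1,1)`, `χ_sgn = (1,−1,1)`, `χ_std = (2,0,−1)`: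
`6⟨χ_perm, χ_ρ⟩ = 6` (multiplicity ONE ⇒ `dim M_{4,L} = 1`), `6⟨χ_ρ,χ_ρ⟩ = 30 = 6(2²+1²)`,
`6⟨χ_ρ,χ_triv⟩ = 0`, `6⟨χ_ρ,χ_sgn⟩ = 12`, `6⟨χ_ρ,χ_std⟩ = 6` (so `ρ_L ≅ sgn² ⊕ std`). -/
theorem character_arithmetic :
    let sizes : List ℤ := [1, 3, 2]
    let ρ : List ℤ := [4, -2, 1]
    let pair := fun (χ : List ℤ) => (List.zipWith3 (fun s a b => s * a * b) sizes ρ χ).sum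
    (pair [3, 1, 0], pair ρ, pair [1, 1, 1], pair [1, -1, 1], pair [2, 0, -1]) = (6, 30, 0, 12, 6) := by
  decide

end Summit.HodgeConjecture.HodgeConjecture.Theorems.HeegnerRankOne
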